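import Mathlib
import HarnessLib
import Summits.NavierStokesRegularity.NavierStokesRegularity.Theorems.PoloidalWindowDoorLrcModEntireParallelWebsIdentity

/-!
# Route `PoloidalWindowDoor`, item `LrcModEntire` (stmt-NavierStokesRegularity-20428), cell (Q4) of the (TH) column —
# PARALLEL WEBS (HUYGENS): on a straight hot branch the homogeneous web at every nearby height is the PARALLEL LINE
# (brick P1 of LEAD memo T2B-g16 §2/§6(iii), class-free)

Cell ns-regularity-ideate, LEAD-lineage seat ns-poloidal-K2-p3 g16 (`--supports stmt-NavierStokesRegularity-20428`).

Setting (one slice): `F : ℝ³ → ℝ` of class `C³`, a horizontal unit vector `e` with `ν = Je`, and a `C²` WEB FUNCTION `G(s,z)` on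
`ℝ × I` (`I` an open interval around `0`) describing the web points `W(s,z) = s·e + G(s,z)·ν + z·e₂` of the cross-sections based on
the line `Γ = ℝe`, with: the horizontal gradient of `F` vanishes on the web (`∂_νF(W) = ∂_eF(W) = 0`), the web values depend on
the height only (`F(W(s,z)) = R(z)`), the RIDGE LAW (`D²F(W)[e,e] + D²F(W)[ν,ν] = −κ(z) < 0`, height-only), the SLICE LAW at the web
(`D²F(W)[e₂,e₂] = −μ(z)(D²F(W)[e,e] + D²F(W)[ν,ν])`), and `G(s,0) = 0` (the base web is the line itself).  Then:

* `huygens_identity` — **`κ(z)·(∂_zG)² = (R″(z) − μ(z)κ(z))·(1 + (∂_sG)²)`** on `ℝ × I` (implicit differentiation of the three web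
  identities; memo §2 display): the normal speed of the web in `z` is the same for all `s`;
* `webFun_eq_of_huygens` — **`G(s,z) = G(0,z)`**: differentiating the identity in `s` gives `κ G_z ∂_zH = c H ∂_sH` for `H = ∂_sG`,
  whence `|∂_zH| ≤ A|H|` along every vertical line (where `G_z = 0` the height is a zero of `c` and `∂_zH = ∂_s G_z = 0`); Grönwall
  from `H(s,0) = 0` kills `H`;
* `parallelWebs` — the package used by the wiring of `stub_Q4line`: the webs are the lines `{s·e + d(z)·ν + z·e₂}` with `d = G(0,·)`,
  and `κ·d′² = R″ − μκ` (so the sheet is non-characteristic at `z` iff `R″(z) ≠ 0`).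

WHAT THIS IS NOT: not a claim about Navier–Stokes regularity; a calculus brick (bears_on LADDER-NS N0 via item 20428).
-/

noncomputable section

set_option linter.dupNamespace false
set_option linter.unusedVariables false

namespace Summit.NavierStokesRegularity.NavierStokesRegularity.Theorems.PoloidalWindowDoorLrcModEntireParallelWebs

open Set Function Filter Topology
open scoped ContDiff
open Summit.NavierStokesRegularity.NavierStokesRegularity.Theorems.PoloidalWindowDoorLrcModEntireSheetFlattenTools
open Summit.NavierStokesRegularity.NavierStokesRegularity.Theorems.PoloidalWindowDoorLrcModEntireParallelWebsIdentity

/-! ### Part C — Huygens: the relation `κ G_z² = c (1 + G_s²)` with `G(·,0) = 0` forces `∂_sG ≡ 0` -/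

/-- Directional derivative of a function on `ℝ × ℝ` along the first axis, as a derivative along the horizontal line. -/
theorem fderiv_apply_one_zero_eq_deriv {K : ℝ × ℝ → ℝ} {p : ℝ × ℝ} (hK : DifferentiableAt ℝ K p) :
    fderiv ℝ K p (1, 0) = deriv (fun s : ℝ => K (s, p.2)) p.1 := by
  have h1 : HasFDerivAt K (fderiv ℝ K p) ((fun s : ℝ => ((s, p.2) : ℝ × ℝ)) p.1) := by simpa using hK.hasFDerivAt
  have h2 : HasDerivAt (fun s : ℝ => ((s, p.2) : ℝ × ℝ)) ((1 : ℝ), (0 : ℝ)) p.1 :=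
    (hasDerivAt_id p.1).prodMk (hasDerivAt_const p.1 p.2)
  exact ((h1.comp_hasDerivAt p.1 h2).deriv).symm

/-- Directional derivative along the second axis, as a derivative along the vertical line. -/
theorem fderiv_apply_zero_one_eq_deriv {K : ℝ × ℝ → ℝ} {p : ℝ × ℝ} (hK : DifferentiableAt ℝ K p) :
    fderiv ℝ K p (0, 1) = deriv (fun z : ℝ => K (p.1, z)) p.2 := by
  have h1 : HasFDerivAt K (fderiv ℝ K p) ((fun z : ℝ => ((p.1, z) : ℝ × ℝ)) p.2) := by simpa using hK.hasFDerivAt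
  have h2 : HasDerivAt (fun z : ℝ => ((p.1, z) : ℝ × ℝ)) ((0 : ℝ), (1 : ℝ)) p.2 :=
    (hasDerivAt_const p.2 p.1).prodMk (hasDerivAt_id p.2)
  exact ((h1.comp_hasDerivAt p.2 h2).deriv).symm

/-- The vertical line through `(s, z)` is differentiable into the plane with derivative `(0,1)`. -/
theorem hasDerivAt_vertical_line (s z : ℝ) : HasDerivAt (fun z : ℝ => ((s, z) : ℝ × ℝ)) ((0 : ℝ), (1 : ℝ)) z :=
  (hasDerivAt_const z s).prodMk (hasDerivAt_id z)

/-- **Grönwall on a symmetric interval**: `|h′| ≤ A|h|` on `[−b, b]` and `h(0) = 0` force `h ≡ 0` there. -/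
theorem eq_zero_of_abs_deriv_le {h : ℝ → ℝ} {A b : ℝ} (hb : 0 ≤ b)
    (hd : ∀ z ∈ Icc (-b) b, HasDerivAt h (deriv h z) z) (hbound : ∀ z ∈ Icc (-b) b, |deriv h z| ≤ A * |h z|)
    (h0 : h 0 = 0) : ∀ z ∈ Icc (-b) b, h z = 0 := by
  have hcont : ∀ z ∈ Icc (-b) b, ContinuousAt h z := fun z hz => (hd z hz).continuousAt
  -- forward
  have hfwd : ∀ z ∈ Icc (0 : ℝ) b, ‖h z‖ ≤ gronwallBound 0 A 0 (z - 0) := by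
    refine norm_le_gronwallBound_of_norm_deriv_right_le (f' := deriv h) ?_ ?_ (by simp [h0]) ?_
    · exact fun z hz => (hcont z ⟨by linarith [hz.1], hz.2⟩).continuousWithinAt
    · exact fun z hz => (hd z ⟨by linarith [hz.1], hz.2.le⟩).hasDerivWithinAt
    · intro z hz
      simpa [Real.norm_eq_abs] using hbound z ⟨by linarith [hz.1], hz.2.le⟩
  -- backward, on the reflected function
  have hbwd : ∀ z ∈ Icc (0 : ℝ) b, ‖h (-z)‖ ≤ gronwallBound 0 A 0 (z - 0) := by
    have hd' : ∀ z ∈ Icc (0 : ℝ) b, HasDerivAt (fun t => h (-t)) (-(deriv h (-z))) z := by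
      intro z hz
      have h1 := hd (-z) ⟨by linarith [hz.2], by linarith [hz.1]⟩
      have h2 := HasDerivAt.scomp z h1 (hasDerivAt_neg z)
      have h3 : HasDerivAt (fun t => h (-t)) ((-1 : ℝ) • deriv h (-z)) z := h2
      simpa using h3
    refine norm_le_gronwallBound_of_norm_deriv_right_le (f := fun t => h (-t)) (f' := fun z => -(deriv h (-z))) ?_ ?_
      (by simp [h0]) ?_
    · exact fun z hz => (hd' z hz).continuousAt.continuousWithinAt
    · exact fun z hz => (hd' z ⟨hz.1, hz.2.le⟩).hasDerivWithinAt
    · intro z hz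
      have := hbound (-z) ⟨by linarith [hz.2], by linarith [hz.1]⟩
      simpa [Real.norm_eq_abs, abs_neg] using this
  intro z hz
  by_cases hz0 : 0 ≤ z
  · have := hfwd z ⟨hz0, hz.2⟩
    simpa [gronwallBound_ε0_δ0] using this
  · have := hbwd (-z) ⟨by linarith, by linarith [hz.1]⟩
    simpa [gronwallBound_ε0_δ0] using this

/-- **HUYGENS ⇒ PARALLEL WEBS.**  Let `G` be `C²` on the open region `ℝ × (−δ₁, δ₁)` with `G(s,0) = 0`, and suppose
`κ(z)·(∂_zG)² = c(z)·(1 + (∂_sG)²)` there with `κ > 0`, `κ, c` differentiable.  Then `G(s,z) = G(0,z)`: the web function does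
not depend on `s`. -/
theorem webFun_eq_of_huygens {G : ℝ × ℝ → ℝ} {δ₁ : ℝ} (hδ₁ : 0 < δ₁)
    (hG : ContDiffOn ℝ 2 G (region (Ioo (-δ₁) δ₁)))
    {κ c : ℝ → ℝ} (hκ : ∀ z ∈ Ioo (-δ₁) δ₁, 0 < κ z)
    (hκd : ∀ z ∈ Ioo (-δ₁) δ₁, DifferentiableAt ℝ κ z) (hcd : ∀ z ∈ Ioo (-δ₁) δ₁, DifferentiableAt ℝ c z)
    (hrel : ∀ p ∈ region (Ioo (-δ₁) δ₁), κ p.2 * (fderiv ℝ G p (0, 1)) ^ 2 = c p.2 * (1 + (fderiv ℝ G p (1, 0)) ^ 2))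
    (h0 : ∀ s : ℝ, G (s, 0) = 0) :
    ∀ s : ℝ, ∀ z ∈ Ioo (-δ₁) δ₁, G (s, z) = G (0, z) := by
  set I := Ioo (-δ₁) δ₁ with hI
  have hIo : IsOpen I := isOpen_Ioo
  have hRo : IsOpen (region I) := isOpen_region hIo
  have h0I : (0 : ℝ) ∈ I := ⟨by linarith, hδ₁⟩
  -- smoothness facts
  have hGat : ∀ p ∈ region I, ContDiffAt ℝ 2 G p := fun p hp => hG.contDiffAt (hRo.mem_nhds hp)
  have hGd : ∀ p ∈ region I, DifferentiableAt ℝ G p := fun p hp => (hGat p hp).differentiableAt (by norm_num)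
  have hDG : ∀ p ∈ region I, DifferentiableAt ℝ (fderiv ℝ G) p := fun p hp =>
    ((hGat p hp).fderiv_right (m := 1) (by norm_num)).differentiableAt (by norm_num)
  set H : ℝ × ℝ → ℝ := fun p => fderiv ℝ G p (1, 0) with hH
  set Z : ℝ × ℝ → ℝ := fun p => fderiv ℝ G p (0, 1) with hZ
  have hHd : ∀ p ∈ region I, DifferentiableAt ℝ H p := fun p hp => (hDG p hp).clm_apply (differentiableAt_const _)
  have hZd : ∀ p ∈ region I, DifferentiableAt ℝ Z p := fun p hp => (hDG p hp).clm_apply (differentiableAt_const _)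
  have hHfd : ∀ p ∈ region I, ∀ w, fderiv ℝ H p w = fderiv ℝ (fderiv ℝ G) p w (1, 0) := fun p hp w => by
    rw [hH, fderiv_clm_apply (hDG p hp) (differentiableAt_const _)]; simp
  have hZfd : ∀ p ∈ region I, ∀ w, fderiv ℝ Z p w = fderiv ℝ (fderiv ℝ G) p w (0, 1) := fun p hp w => by
    rw [hZ, fderiv_clm_apply (hDG p hp) (differentiableAt_const _)]; simp
  -- symmetry of the mixed partials: `∂_s Z = ∂_z H`
  have hmix : ∀ p ∈ region I, fderiv ℝ Z p (1, 0) = fderiv ℝ H p (0, 1) := fun p hp => by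
    rw [hHfd p hp, hZfd p hp]
    exact (hGat p hp).isSymmSndFDerivAt (by simp) (1, 0) (0, 1)
  -- `H` is `C¹` on the region (for the continuity of `∂_sH`)
  have hH1 : ContDiffOn ℝ 1 H (region I) := by
    have h := (hG.fderiv_of_isOpen hRo (m := 1) (by norm_num)).clm_apply contDiffOn_const (g := fun _ => ((1 : ℝ), (0 : ℝ)))
    exact h
  have hHcont : ContinuousOn (fun p => fderiv ℝ H p (1, 0)) (region I) :=
    ((hH1.fderiv_of_isOpen hRo (m := 0) (by norm_num)).continuousOn).clm_apply continuousOn_const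
  -- (T): the `s`-derivative of the relation
  have hT : ∀ p ∈ region I, κ p.2 * Z p * fderiv ℝ H p (0, 1) = c p.2 * H p * fderiv ℝ H p (1, 0) := by
    intro p hp
    have hκp : DifferentiableAt ℝ (fun q : ℝ × ℝ => κ q.2) p := (hκd p.2 hp).comp p differentiableAt_snd
    have hcp : DifferentiableAt ℝ (fun q : ℝ × ℝ => c q.2) p := (hcd p.2 hp).comp p differentiableAt_snd
    have hκ0 : fderiv ℝ (fun q : ℝ × ℝ => κ q.2) p (1, 0) = 0 := by
      rw [show (fun q : ℝ × ℝ => κ q.2) = κ ∘ Prod.snd from rfl, fderiv_comp p (hκd p.2 hp) differentiableAt_snd]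
      simp [fderiv_snd]
    have hc0 : fderiv ℝ (fun q : ℝ × ℝ => c q.2) p (1, 0) = 0 := by
      rw [show (fun q : ℝ × ℝ => c q.2) = c ∘ Prod.snd from rfl, fderiv_comp p (hcd p.2 hp) differentiableAt_snd]
      simp [fderiv_snd]
    have hΦ : ∀ q ∈ region I, (fun q : ℝ × ℝ => κ q.2 * (Z q * Z q) - c q.2 * (1 + H q * H q)) q = 0 := fun q hq => by
      have := hrel q hq
      simp only [hH, hZ]
      nlinarith [this]
    have h := fderiv_eq_zero_of_eqOn_region hIo hΦ hp (1, 0)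
    have hκ' : HasFDerivAt (fun q : ℝ × ℝ => κ q.2) ((fderiv ℝ κ p.2).comp (ContinuousLinearMap.snd ℝ ℝ ℝ)) p :=
      (hκd p.2 hp).hasFDerivAt.comp p hasFDerivAt_snd
    have hc' : HasFDerivAt (fun q : ℝ × ℝ => c q.2) ((fderiv ℝ c p.2).comp (ContinuousLinearMap.snd ℝ ℝ ℝ)) p :=
      (hcd p.2 hp).hasFDerivAt.comp p hasFDerivAt_snd
    have hZ' : HasFDerivAt Z (fderiv ℝ Z p) p := (hZd p hp).hasFDerivAt
    have hH' : HasFDerivAt H (fderiv ℝ H p) p := (hHd p hp).hasFDerivAt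
    have hΦ' := (hκ'.mul (hZ'.mul hZ')).sub (hc'.mul ((hasFDerivAt_const (1 : ℝ) p).add (hH'.mul hH')))
    have hΦ'' : HasFDerivAt (fun q : ℝ × ℝ => κ q.2 * (Z q * Z q) - c q.2 * (1 + H q * H q)) _ p := hΦ'
    rw [hΦ''.fderiv] at h
    simp only [_root_.sub_apply, _root_.add_apply, _root_.smul_apply, smul_eq_mul, ContinuousLinearMap.coe_comp,
      Function.comp_apply, ContinuousLinearMap.coe_snd', Pi.mul_apply, Pi.add_apply, map_zero, mul_zero,
      add_zero, zero_add] at h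
    rw [hmix p hp] at h
    linear_combination h / 2
  -- where `G_z = 0` the height is a zero of `c` and `∂_zH = 0`
  have hdeg : ∀ p ∈ region I, Z p = 0 → fderiv ℝ H p (0, 1) = 0 := by
    intro p hp hZ0
    have hc0 : c p.2 = 0 := by
      have h := hrel p hp
      rw [show fderiv ℝ G p (0, 1) = Z p from rfl, hZ0] at h
      have h1 : c p.2 * (1 + H p ^ 2) = 0 := by rw [show fderiv ℝ G p (1, 0) = H p from rfl] at h; linarith
      rcases mul_eq_zero.1 h1 with h2 | h2
      · exact h2
      · nlinarith [sq_nonneg (H p)]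
    -- `Z` vanishes on the whole horizontal line at this height
    have hZline : ∀ s : ℝ, Z (s, p.2) = 0 := by
      intro s
      have hq : ((s, p.2) : ℝ × ℝ) ∈ region I := hp
      have h := hrel (s, p.2) hq
      rw [hc0, zero_mul] at h
      have := mul_eq_zero.1 h
      rcases this with h1 | h1
      · exact absurd h1 (hκ p.2 hp).ne'
      · exact pow_eq_zero_iff (n := 2) (by norm_num) |>.1 h1
    rw [← hmix p hp, fderiv_apply_one_zero_eq_deriv (hZd p hp)]
    have : (fun s : ℝ => Z (s, p.2)) = fun _ => 0 := funext hZline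
    rw [this, deriv_const]
  -- the Grönwall bound along a vertical segment
  have hmain : ∀ (s : ℝ) (b : ℝ), 0 ≤ b → b < δ₁ → ∀ z ∈ Icc (-b) b, H (s, z) = 0 := by
    intro s b hb hbδ
    have hKI : ∀ z ∈ Icc (-b) b, z ∈ I := fun z hz => ⟨by linarith [hz.1], by linarith [hz.2]⟩
    -- a bound `A` for `√(c/κ)·|∂_sH|` on the segment
    obtain ⟨A, hA⟩ : ∃ A, ∀ z ∈ Icc (-b) b, Real.sqrt (c z / κ z) * |fderiv ℝ H (s, z) (1, 0)| ≤ A := by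
      have hcont : ContinuousOn (fun z => Real.sqrt (c z / κ z) * |fderiv ℝ H (s, z) (1, 0)|) (Icc (-b) b) := by
        have hcκ : ContinuousOn (fun z => c z / κ z) (Icc (-b) b) := by
          refine ContinuousOn.div ?_ ?_ fun z hz => (hκ z (hKI z hz)).ne'
          · exact fun z hz => (hcd z (hKI z hz)).continuousAt.continuousWithinAt
          · exact fun z hz => (hκd z (hKI z hz)).continuousAt.continuousWithinAt
        have hline : ContinuousOn (fun z : ℝ => ((s, z) : ℝ × ℝ)) (Icc (-b) b) := (continuous_const.prodMk continuous_id).continuousOn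
        have h2 : ContinuousOn (fun z => fderiv ℝ H (s, z) (1, 0)) (Icc (-b) b) :=
          hHcont.comp hline fun z hz => hKI z hz
        exact (hcκ.sqrt).mul (continuous_abs.comp_continuousOn h2)
      obtain ⟨A, hA⟩ := (isCompact_Icc : IsCompact (Icc (-b) b)).exists_bound_of_continuousOn hcont
      exact ⟨A, fun z hz => (le_abs_self _).trans (by simpa [Real.norm_eq_abs] using hA z hz)⟩
    -- the differential inequality
    set h : ℝ → ℝ := fun z => H (s, z) with hh
    have hhd : ∀ z ∈ Icc (-b) b, HasDerivAt h (fderiv ℝ H (s, z) (0, 1)) z := by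
      intro z hz
      have hp : ((s, z) : ℝ × ℝ) ∈ region I := hKI z hz
      have h1 : HasFDerivAt H (fderiv ℝ H (s, z)) ((fun z : ℝ => ((s, z) : ℝ × ℝ)) z) := (hHd _ hp).hasFDerivAt
      exact h1.comp_hasDerivAt z (hasDerivAt_vertical_line s z)
    have hderiv : ∀ z ∈ Icc (-b) b, deriv h z = fderiv ℝ H (s, z) (0, 1) := fun z hz => (hhd z hz).deriv
    have hineq : ∀ z ∈ Icc (-b) b, |deriv h z| ≤ A * |h z| := by
      intro z hz
      have hzI : z ∈ I := hKI z hz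
      have hp : ((s, z) : ℝ × ℝ) ∈ region I := hzI
      have hA0 : 0 ≤ A := le_trans (mul_nonneg (Real.sqrt_nonneg _) (abs_nonneg _)) (hA z hz)
      rw [hderiv z hz]
      by_cases hZ0 : Z (s, z) = 0
      · rw [hdeg _ hp hZ0, abs_zero]
        exact mul_nonneg hA0 (abs_nonneg _)
      · have hκz : 0 < κ z := hκ z hzI
        have hr := hrel (s, z) hp
        change κ z * Z (s, z) ^ 2 = c z * (1 + H (s, z) ^ 2) at hr
        have hc0 : 0 ≤ c z := by
          have h1 : 0 ≤ c z * (1 + H (s, z) ^ 2) := by rw [← hr]; positivity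
          nlinarith [sq_nonneg (H (s, z))]
        set q : ℝ := Real.sqrt (c z / κ z) with hq
        have hq0 : 0 ≤ q := Real.sqrt_nonneg _
        have hq2 : q ^ 2 = c z / κ z := Real.sq_sqrt (div_nonneg hc0 hκz.le)
        have hqZ : q ≤ |Z (s, z)| := by
          have h1 : q ^ 2 ≤ |Z (s, z)| ^ 2 := by
            rw [hq2, sq_abs, div_le_iff₀ hκz]
            nlinarith [sq_nonneg (H (s, z)), sq_nonneg (Z (s, z))]
          exact (pow_le_pow_iff_left₀ hq0 (abs_nonneg _) two_ne_zero).1 h1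
        have hTz := hT (s, z) hp
        change κ z * Z (s, z) * fderiv ℝ H (s, z) (0, 1) = c z * H (s, z) * fderiv ℝ H (s, z) (1, 0) at hTz
        -- `c ≤ κ q |Z|`
        have hcle : c z ≤ κ z * q * |Z (s, z)| := by
          have : c z = κ z * q ^ 2 := by rw [hq2]; field_simp
          rw [this]
          have := mul_le_mul_of_nonneg_left hqZ (mul_nonneg hκz.le hq0)
          nlinarith [this]
        have habs : κ z * |Z (s, z)| * |fderiv ℝ H (s, z) (0, 1)| = c z * |H (s, z)| * |fderiv ℝ H (s, z) (1, 0)| := by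
          have := congrArg abs hTz
          simpa [abs_mul, abs_of_pos hκz, abs_of_nonneg hc0, mul_assoc] using this
        have hZpos : 0 < |Z (s, z)| := abs_pos.2 hZ0
        have hprod : 0 < κ z * |Z (s, z)| := mul_pos hκz hZpos
        -- divide
        have hgoal : |fderiv ℝ H (s, z) (0, 1)| ≤ q * |fderiv ℝ H (s, z) (1, 0)| * |H (s, z)| := by
          refine le_of_mul_le_mul_left ?_ hprod
          calc κ z * |Z (s, z)| * |fderiv ℝ H (s, z) (0, 1)|
              = c z * |H (s, z)| * |fderiv ℝ H (s, z) (1, 0)| := habs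
            _ ≤ (κ z * q * |Z (s, z)|) * |H (s, z)| * |fderiv ℝ H (s, z) (1, 0)| := by
                gcongr
            _ = κ z * |Z (s, z)| * (q * |fderiv ℝ H (s, z) (1, 0)| * |H (s, z)|) := by ring
        calc |fderiv ℝ H (s, z) (0, 1)| ≤ q * |fderiv ℝ H (s, z) (1, 0)| * |H (s, z)| := hgoal
          _ ≤ A * |H (s, z)| := by
              have := hA z hz
              exact mul_le_mul_of_nonneg_right this (abs_nonneg _)
    have hh0 : h 0 = 0 := by
      change H (s, 0) = 0
      have hp0 : ((s, (0 : ℝ)) : ℝ × ℝ) ∈ region I := h0I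
      change fderiv ℝ G (s, 0) (1, 0) = 0
      rw [fderiv_apply_one_zero_eq_deriv (hGd _ hp0)]
      have : (fun s' : ℝ => G (s', ((s, (0 : ℝ)) : ℝ × ℝ).2)) = fun _ => 0 := funext fun s' => h0 s'
      rw [this, deriv_const]
    have hhd' : ∀ z ∈ Icc (-b) b, HasDerivAt h (deriv h z) z := fun z hz => by rw [hderiv z hz]; exact hhd z hz
    exact eq_zero_of_abs_deriv_le hb hhd' hineq hh0
  -- conclusion
  intro s z hz
  set b : ℝ := (|z| + δ₁) / 2 with hb
  have hzabs : |z| < δ₁ := abs_lt.2 ⟨by linarith [hz.1], hz.2⟩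
  have hb0 : 0 ≤ b := by rw [hb]; positivity
  have hbδ : b < δ₁ := by rw [hb]; linarith
  have hzb : z ∈ Icc (-b) b := by
    constructor <;> [have := neg_abs_le z; have := le_abs_self z] <;> rw [hb] <;> linarith
  -- `s ↦ G(s,z)` has zero derivative everywhere
  have hline : ∀ s' : ℝ, HasDerivAt (fun s'' : ℝ => G (s'', z)) 0 s' := by
    intro s'
    have hp : ((s', z) : ℝ × ℝ) ∈ region I := hz
    have h1 : HasFDerivAt G (fderiv ℝ G (s', z)) ((fun s'' : ℝ => ((s'', z) : ℝ × ℝ)) s') := (hGd _ hp).hasFDerivAt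
    have h2 : HasDerivAt (fun s'' : ℝ => ((s'', z) : ℝ × ℝ)) ((1 : ℝ), (0 : ℝ)) s' :=
      (hasDerivAt_id s').prodMk (hasDerivAt_const s' z)
    have h3 : HasDerivAt (fun s'' : ℝ => G (s'', z)) (fderiv ℝ G (s', z) ((1 : ℝ), (0 : ℝ))) s' := h1.comp_hasDerivAt s' h2
    have hH0 : fderiv ℝ G (s', z) (1, 0) = 0 := hmain s' b hb0 hbδ z hzb
    rw [hH0] at h3
    exact h3
  exact is_const_of_deriv_eq_zero (fun s' => (hline s').differentiableAt) (fun s' => (hline s').deriv) s 0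

/-! ### Part D — the package for the wiring of `stub_Q4line` -/

/-- **PARALLEL WEBS** (memo T2B-g16 §2, BY NAME for the wiring).  Under the hypotheses of `huygens_identity` on the open
region `ℝ × (−δ₁, δ₁)` with a `C²` web function `G`, `G(s,0) = 0`, `κ > 0`, and `κ`, `R″ − μκ` differentiable, the web function is
`s`-independent: `G(s,z) = G(0,z)`. -/
theorem parallelWebs {F : EuclideanSpace ℝ (Fin 3) → ℝ} (hF : ContDiff ℝ 3 F) (e : EuclideanSpace ℝ (Fin 3))
    {δ₁ : ℝ} (hδ₁ : 0 < δ₁) {G : ℝ × ℝ → ℝ} (hG : ContDiffOn ℝ 2 G (region (Ioo (-δ₁) δ₁)))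
    {R κ μ : ℝ → ℝ} (hR : ∀ z ∈ Ioo (-δ₁) δ₁, HasDerivAt (deriv R) (deriv (deriv R) z) z)
    (hR1 : ∀ z ∈ Ioo (-δ₁) δ₁, DifferentiableAt ℝ R z)
    (hκ : ∀ z ∈ Ioo (-δ₁) δ₁, 0 < κ z) (hκd : ∀ z ∈ Ioo (-δ₁) δ₁, DifferentiableAt ℝ κ z)
    (hcd : ∀ z ∈ Ioo (-δ₁) δ₁, DifferentiableAt ℝ (fun z => deriv (deriv R) z - μ z * κ z) z)
    (hν : ∀ p ∈ region (Ioo (-δ₁) δ₁), fderiv ℝ F (webMap e G p) (Jvec e) = 0)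
    (he : ∀ p ∈ region (Ioo (-δ₁) δ₁), fderiv ℝ F (webMap e G p) e = 0)
    (hval : ∀ p ∈ region (Ioo (-δ₁) δ₁), F (webMap e G p) = R p.2)
    (hridge : ∀ p ∈ region (Ioo (-δ₁) δ₁), fderiv ℝ (fderiv ℝ F) (webMap e G p) e e +
      fderiv ℝ (fderiv ℝ F) (webMap e G p) (Jvec e) (Jvec e) = -κ p.2)
    (hslice : ∀ p ∈ region (Ioo (-δ₁) δ₁), fderiv ℝ (fderiv ℝ F) (webMap e G p) e2 e2 =
      -μ p.2 * (fderiv ℝ (fderiv ℝ F) (webMap e G p) e e + fderiv ℝ (fderiv ℝ F) (webMap e G p) (Jvec e) (Jvec e)))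
    (h0 : ∀ s : ℝ, G (s, 0) = 0) :
    ∀ s : ℝ, ∀ z ∈ Ioo (-δ₁) δ₁, G (s, z) = G (0, z) := by
  have hGd : ∀ p ∈ region (Ioo (-δ₁) δ₁), DifferentiableAt ℝ G p := fun p hp =>
    (hG.contDiffAt ((isOpen_region isOpen_Ioo).mem_nhds hp)).differentiableAt (by norm_num)
  have hrel : ∀ p ∈ region (Ioo (-δ₁) δ₁), κ p.2 * (fderiv ℝ G p (0, 1)) ^ 2 =
      (fun z => deriv (deriv R) z - μ z * κ z) p.2 * (1 + (fderiv ℝ G p (1, 0)) ^ 2) := fun p hp =>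
    huygens_identity hF e isOpen_Ioo hGd hR hR1 hν he hval hridge hslice hp
  exact webFun_eq_of_huygens hδ₁ hG hκ hκd hcd hrel h0

end Summit.NavierStokesRegularity.NavierStokesRegularity.Theorems.PoloidalWindowDoorLrcModEntireParallelWebs
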